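import Literature.AlgebraicGeometry.Resolution.BlowupChartRsopIdeals
import Literature.AlgebraicGeometry.Resolution.BlowupAlgebraStrictTransform
import Literature.AlgebraicGeometry.Resolution.RegularLocalRingsProofs
import HarnessLib

/-!
# `WildQuotients.SummitReduction` (stmt-ResolutionOfSingularities-16324), line `FramePerfect`, stub O3
# (`stub_pair_orbitNormalFormBlowup_chartsOverCentre`): the charts of the embedded blow-up —
# affine blowup algebras of part of a regular system of parameters, and the strict transform of
# the order-two relation `c₀c₁ - c₂c₃H`

Route `ResolutionOfSingularities/WildQuotients`, crux `SummitReduction`; helper file of stub O3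
(de Jong 1996, 4.27 [C2] on the coefficient-free model `M = A⟦u, v⟧/(uv - ∏_{i<s} tᵢ)`). The
model is blown up EMBEDDED: `M = P/(F)` for the regular local ring `P = A⟦u, v⟧`, the relation
`F = uv - t_a t_b · h''` of order two along the centre `𝔓 = (u, v, t_a, t_b)`, which is generated by
PART `c = (c₀, c₁, c₂, c₃)` of a regular system of parameters `(c, w)` of `P`. This file provides
the chart-level algebra, for any regular local `R` in place of `P` (all PROVED):

* `chartsOverCentre_exists_reesChart_equiv`, `chartsOverCentre_exists_chartQuotEquiv` — the Rees
  chart `(R[𝔓t])_{(c_j t)}` of the tree (`BlowupChartRsop.lean`) is the affine blowup algebra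
  `R[𝔓/c_j] ⊆ R[1/c_j]`, and `(R/𝔓)[T_k : k ≠ j] ≅ R[𝔓/c_j]/(c_j)` (Stacks 0BIQ);
* `chartsOverCentre_isRsopPart_chartFamily` — at a prime `𝔔` of `R[𝔓/c_j]` over `𝔪_R`,
  `(c_j, (c_k/c_j)_{k ∈ J}, w)` is part of a regular system of parameters of `R[𝔓/c_j]_𝔔` (the
  tree's `isRsopPart_chartFamily`);
* `chartsOverCentre_prime_algebraMap` — `c_j` is a prime element of `R[𝔓/c_j]`;
* `chartsOverCentre_algebraMap_relation`, `chartsOverCentre_strictTransform_notMem`,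
  `chartsOverCentre_exists_strictTransform_equiv` — for `F = c₀c₁ - c₂c₃H`: `F = c_j² f` with the
  strict transform `f = (c₀/c_j)(c₁/c_j) - (c₂/c_j)(c₃/c_j)H ∉ (c_j)`, and
  **`R[𝔓/c_j]/(f) ≅ (R/(F))[𝔓̄/c̄_j]`**: the charts of the blow-up of `Spec R/(F)` in `𝔓̄` are the
  strict transforms (de Jong 1996, p. 76: "equations `u = t₁u'`, `v = t₁v'`, `t₂ = t₁t₂'` and
  `u'v' - t₂'t₃ ⋯ t_s = 0`").

## Sources

* A. J. de Jong, *Smoothness, semi-stability and alterations*, Publ. Math. IHÉS 83 (1996), 4.27,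
  p. 76. [DeJong1996]
* U. Görtz, T. Wedhorn, *Algebraic Geometry I*, 2nd ed. (2020), (13.19) and Prop. 13.96 (2).
  [GortzWedhorn2020]
* The Stacks Project, Tags 0804, 0BIQ. [StacksProject]
* H. Matsumura, *Commutative Ring Theory* (1986), Thm. 14.3. [Matsumura1987]
-/

set_option linter.dupNamespace false -- the tree's summit namespace repeats `ResolutionOfSingularities`

noncomputable section

open IsLocalRing HomogeneousLocalization
open Literature.AlgebraicGeometry.Resolution

namespace Summit.ResolutionOfSingularities.ResolutionOfSingularities.Theorems

universe u

/-! ## The Rees chart is the affine blowup algebra -/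

/-- **The Rees chart ring is the affine blowup algebra**, `(R[𝔓t])_{(c_j t)} ≅ R[𝔓/c_j]`
(`reesChartEquiv`), compatibly with the structure maps and carrying the chart generators
`(c_k t)/(c_j t)` to `c_k/c_j`. [cite: StacksProject, Tag 0804] -/
theorem chartsOverCentre_exists_reesChart_equiv {R : Type u} [CommRing R] {n : ℕ} (c : Fin n → R)
    (j : Fin n) (𝔓 : Ideal R) (h𝔓 : 𝔓 = Ideal.span (Set.range c)) (hc : ∀ k, c k ∈ 𝔓) :
    ∃ Λ : chartRing c j ≃+* blowupAlgebra 𝔓 (c j),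
      (∀ r, Λ (chartBase c j r) = algebraMap R _ r) ∧
      (∀ k, Λ (chartGen c j k) = blowupAlgebra.gen 𝔓 (c j) (c k) (hc k)) := by
  subst h𝔓
  refine ⟨reesChartEquiv (c j) (Ideal.mem_span_range_self (f := c) (x := j)),
    reesChartEquiv_reesChartBase _ _, fun k => Subtype.ext ?_⟩
  rw [coe_reesChartEquiv, chartGen, reesChart_mk (c j) _ _ (r := c k) (by rw [coe_reesT]), pow_one,
    blowupAlgebra.coe_gen]

/-- **`(R/𝔓)[T_k : k ≠ j] ≅ R[𝔓/c_j]/(c_j)`** for `𝔓 = (c)` generated by part of a regular system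
of parameters `(c, w)` of the regular local ring `R` (the tree's `chartQuotEquiv` for the Rees
chart, Stacks 0BIQ, moved to the affine blowup algebra), compatibly with `R → ·` and the
variables `T_k ↦ c_k/c_j`. [cite: StacksProject, Tag 0BIQ] -/
theorem chartsOverCentre_exists_chartQuotEquiv {R : Type u} [CommRing R] [IsRegularLocalRing R]
    {n : ℕ} (c : Fin n → R) (j : Fin n) {l : ℕ} (w : Fin l → R)
    (hz : Ideal.span (Set.range (Fin.append c w)) = maximalIdeal R)
    (hd : (maximalIdeal R).spanFinrank = n + l)
    (𝔓 : Ideal R) (h𝔓 : 𝔓 = Ideal.span (Set.range c)) (hc : ∀ k, c k ∈ 𝔓) :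
    ∃ ε : MvPolynomial {k : Fin n // k ≠ j} (R ⧸ Ideal.span (Set.range c)) ≃+*
        blowupAlgebra 𝔓 (c j) ⧸ Ideal.span {algebraMap R (blowupAlgebra 𝔓 (c j)) (c j)},
      (∀ r : R, ε (MvPolynomial.C (Ideal.Quotient.mk _ r)) = Ideal.Quotient.mk _ (algebraMap R _ r)) ∧
      (∀ k : {k : Fin n // k ≠ j}, ε (MvPolynomial.X k) =
        Ideal.Quotient.mk _ (blowupAlgebra.gen 𝔓 (c j) (c k) (hc k))) := by
  obtain ⟨Λ, hΛC, hΛX⟩ := chartsOverCentre_exists_reesChart_equiv c j 𝔓 h𝔓 hc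
  have hK : Ideal.span {algebraMap R (blowupAlgebra 𝔓 (c j)) (c j)} =
      (Ideal.span {chartBase c j (c j)}).map (Λ : chartRing c j →+* blowupAlgebra 𝔓 (c j)) := by
    rw [Ideal.map_span, Set.image_singleton, RingHom.coe_coe, hΛC]
  have hqr := isQuasiRegular_centre c w hz hd
  let ε₂ : (chartRing c j ⧸ Ideal.span {chartBase c j (c j)}) ≃+*
      (blowupAlgebra 𝔓 (c j) ⧸ Ideal.span {algebraMap R (blowupAlgebra 𝔓 (c j)) (c j)}) :=
    Ideal.quotientEquiv _ _ Λ hK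
  have hε₂ : ∀ z, ε₂ (Ideal.Quotient.mk _ z) = Ideal.Quotient.mk _ (Λ z) := fun z => rfl
  refine ⟨(chartQuotEquiv c j hqr).trans ε₂, fun r => ?_, fun k => ?_⟩
  · rw [← hΛC r, ← hε₂, ← chartQuotMap_C, ← chartQuotEquiv_apply c j hqr]
    rfl
  · rw [← hΛX k, ← hε₂, ← chartQuotMap_X, ← chartQuotEquiv_apply c j hqr]
    rfl

/-! ## Regular systems of parameters on the chart -/

/-- **Blowing up part of a regular system of parameters, on the affine blowup algebra**: for a
regular local ring `R` with regular system of parameters `(c, w)`, `𝔓 = (c)`, a prime `𝔔` of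
`R[𝔓/c_j]` over `𝔪_R` and a localisation `L` of `R[𝔓/c_j]` at `𝔔`, the family
`(c_j, (c_k/c_j)_{k ∈ J}, w)` — `J` any injective enumeration of indices `k ≠ j` with
`c_k/c_j ∈ 𝔔` — is part of a regular system of parameters of `L` (the tree's abstract
`isRsopPart_chartFamily`, fed with `(R/𝔓)[T_k : k ≠ j] ≅ R[𝔓/c_j]/(c_j)`).
[cite: DeJong1996, 2.4 with 4.26–4.27] [cite: StacksProject, Tag 0BIQ] -/
theorem chartsOverCentre_isRsopPart_chartFamily {R : Type u} [CommRing R] [IsRegularLocalRing R]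
    {n : ℕ} (c : Fin n → R) (j : Fin n) {l : ℕ} (w : Fin l → R)
    (hz : Ideal.span (Set.range (Fin.append c w)) = maximalIdeal R)
    (hd : (maximalIdeal R).spanFinrank = n + l)
    (𝔓 : Ideal R) (h𝔓 : 𝔓 = Ideal.span (Set.range c)) (hc : ∀ k, c k ∈ 𝔓)
    (𝔔 : Ideal (blowupAlgebra 𝔓 (c j))) [𝔔.IsPrime]
    (h𝔔 : 𝔔.comap (algebraMap R (blowupAlgebra 𝔓 (c j))) = maximalIdeal R)
    (L : Type u) [CommRing L] [IsLocalRing L] [Algebra (blowupAlgebra 𝔓 (c j)) L]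
    [IsLocalization.AtPrime L 𝔔] {a : ℕ} (jJ : Fin a → {k : Fin n // k ≠ j})
    (hjJ : Function.Injective jJ)
    (hJ : ∀ t, blowupAlgebra.gen 𝔓 (c j) (c (jJ t).1) (hc _) ∈ 𝔔) :
    IsRsopPart (chartFamily c j w L (algebraMap R (blowupAlgebra 𝔓 (c j)))
      (fun k => blowupAlgebra.gen 𝔓 (c j) (c k) (hc k)) jJ) := by
  obtain ⟨Λ, -, -⟩ := chartsOverCentre_exists_reesChart_equiv c j 𝔓 h𝔓 hc
  haveI : IsNoetherianRing (chartRing c j) := isNoetherianRing_blowupChart c j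
  haveI : IsNoetherianRing (blowupAlgebra 𝔓 (c j)) := isNoetherianRing_of_ringEquiv (chartRing c j) Λ
  obtain ⟨ε, hεC, hεX⟩ := chartsOverCentre_exists_chartQuotEquiv c j w hz hd 𝔓 h𝔓 hc
  exact isRsopPart_chartFamily c j w hz hd L (algebraMap R _)
    (fun k => blowupAlgebra.gen 𝔓 (c j) (c k) (hc k)) algebraMap_mem_nonZeroDivisors_blowupAlgebra
    ε hεC hεX 𝔔 h𝔔 jJ hjJ hJ

/-! ## The strict transform of the order-two relation -/

/-- **The exceptional generator `c_j` is a prime element of `R[𝔓/c_j]`**: the quotient is the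
polynomial ring `(R/𝔓)[T_k : k ≠ j]` over the regular local ring `R/𝔓`, a domain
(Matsumura 14.3). [cite: StacksProject, Tag 0BIQ] [cite: Matsumura1987, Thm. 14.3] -/
theorem chartsOverCentre_prime_algebraMap {R : Type u} [CommRing R] [IsRegularLocalRing R]
    {n : ℕ} (c : Fin n → R) (j : Fin n) {l : ℕ} (w : Fin l → R)
    (hz : Ideal.span (Set.range (Fin.append c w)) = maximalIdeal R)
    (hd : (maximalIdeal R).spanFinrank = n + l)
    (𝔓 : Ideal R) (h𝔓 : 𝔓 = Ideal.span (Set.range c)) (hc : ∀ k, c k ∈ 𝔓) :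
    Prime (algebraMap R (blowupAlgebra 𝔓 (c j)) (c j)) := by
  obtain ⟨ε, -, -⟩ := chartsOverCentre_exists_chartQuotEquiv c j w hz hd 𝔓 h𝔓 hc
  haveI := isRegularLocalRing_quot_centre c w hz hd
  haveI : IsDomain (R ⧸ Ideal.span (Set.range c)) := isDomain_of_isRegularLocalRing _
  haveI : IsDomain (blowupAlgebra 𝔓 (c j) ⧸ Ideal.span {algebraMap R (blowupAlgebra 𝔓 (c j)) (c j)}) :=
    ε.toMulEquiv.isDomain_iff.mp inferInstance
  haveI : Nontrivial (blowupAlgebra 𝔓 (c j)) :=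
    (Ideal.Quotient.mk (Ideal.span {algebraMap R (blowupAlgebra 𝔓 (c j)) (c j)})).domain_nontrivial
  have hne : algebraMap R (blowupAlgebra 𝔓 (c j)) (c j) ≠ 0 :=
    nonZeroDivisors.ne_zero algebraMap_mem_nonZeroDivisors_blowupAlgebra
  exact (Ideal.span_singleton_prime hne).mp ((Ideal.Quotient.isDomain_iff_prime _).mp inferInstance)

/-- **The total transform of the order-two relation on the chart `D₊(c_j)`** (de Jong 1996, 4.27:
"equations `u = t₁u'`, `v = t₁v'`, `t₂ = t₁t₂'` and `u'v' - t₂'t₃ ⋯ t_s = 0`", i.e.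
`uv - t₁ ⋯ t_s = t₁² (u'v' - t₂' t₃ ⋯ t_s)`): for `F = c₀c₁ - c₂c₃H`, `F = c_j² · f` in `R[𝔓/c_j]`
with `f = (c₀/c_j)(c₁/c_j) - (c₂/c_j)(c₃/c_j) H`. [cite: DeJong1996, 4.27, p. 76] -/
theorem chartsOverCentre_algebraMap_relation {R : Type u} [CommRing R] (c : Fin 4 → R)
    (𝔓 : Ideal R) (hc : ∀ k, c k ∈ 𝔓) (j : Fin 4) (H : R) :
    algebraMap R (blowupAlgebra 𝔓 (c j)) (c 0 * c 1 - c 2 * c 3 * H) =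
      algebraMap R (blowupAlgebra 𝔓 (c j)) (c j) ^ 2 *
        (blowupAlgebra.gen 𝔓 (c j) (c 0) (hc 0) * blowupAlgebra.gen 𝔓 (c j) (c 1) (hc 1) -
          blowupAlgebra.gen 𝔓 (c j) (c 2) (hc 2) * blowupAlgebra.gen 𝔓 (c j) (c 3) (hc 3) *
            algebraMap R (blowupAlgebra 𝔓 (c j)) H) := by
  simp only [map_sub, map_mul]
  rw [← blowupAlgebra.gen_mul_algebraMap 𝔓 (c j) (c 0) (hc 0),
    ← blowupAlgebra.gen_mul_algebraMap 𝔓 (c j) (c 1) (hc 1),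
    ← blowupAlgebra.gen_mul_algebraMap 𝔓 (c j) (c 2) (hc 2),
    ← blowupAlgebra.gen_mul_algebraMap 𝔓 (c j) (c 3) (hc 3)]
  ring

/-- **The strict transform `f` is not divisible by `c_j` in `R[𝔓/c_j]`**: modulo `c_j` it is the
polynomial `T₀T₁ - T₂T₃H̄` (`T_j = 1`) of `(R/𝔓)[T_k : k ≠ j]`, which the substitution
`T₀, T₁ ↦ X`, `T₂, T₃ ↦ 0` sends to a power of `X ≠ 0`. [cite: DeJong1996, 4.27, p. 76] -/
theorem chartsOverCentre_strictTransform_notMem {R : Type u} [CommRing R] [IsRegularLocalRing R]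
    (c : Fin 4 → R) (j : Fin 4) {l : ℕ} (w : Fin l → R)
    (hz : Ideal.span (Set.range (Fin.append c w)) = maximalIdeal R)
    (hd : (maximalIdeal R).spanFinrank = 4 + l)
    (𝔓 : Ideal R) (h𝔓 : 𝔓 = Ideal.span (Set.range c)) (hc : ∀ k, c k ∈ 𝔓) (H : R) :
    blowupAlgebra.gen 𝔓 (c j) (c 0) (hc 0) * blowupAlgebra.gen 𝔓 (c j) (c 1) (hc 1) -
        blowupAlgebra.gen 𝔓 (c j) (c 2) (hc 2) * blowupAlgebra.gen 𝔓 (c j) (c 3) (hc 3) *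
          algebraMap R (blowupAlgebra 𝔓 (c j)) H ∉
      Ideal.span {algebraMap R (blowupAlgebra 𝔓 (c j)) (c j)} := by
  classical
  obtain ⟨ε, hεC, hεX⟩ := chartsOverCentre_exists_chartQuotEquiv c j w hz hd 𝔓 h𝔓 hc
  haveI := isRegularLocalRing_quot_centre c w hz hd
  haveI : IsDomain (R ⧸ Ideal.span (Set.range c)) := isDomain_of_isRegularLocalRing _
  -- the variables `T_k` (`T_j = 1`) and their images
  let T : Fin 4 → MvPolynomial {k : Fin 4 // k ≠ j} (R ⧸ Ideal.span (Set.range c)) := fun k =>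
    if h : k = j then 1 else MvPolynomial.X ⟨k, h⟩
  have hT : ∀ k, ε (T k) = Ideal.Quotient.mk _ (blowupAlgebra.gen 𝔓 (c j) (c k) (hc k)) := by
    intro k
    by_cases h : k = j
    · subst h
      simp only [T, dif_pos rfl, map_one, blowupAlgebra.gen_self, map_one]
    · simp only [T, dif_neg h, hεX]
  intro hmem
  have h0 : Ideal.Quotient.mk (Ideal.span {algebraMap R (blowupAlgebra 𝔓 (c j)) (c j)})
      (blowupAlgebra.gen 𝔓 (c j) (c 0) (hc 0) * blowupAlgebra.gen 𝔓 (c j) (c 1) (hc 1) -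
        blowupAlgebra.gen 𝔓 (c j) (c 2) (hc 2) * blowupAlgebra.gen 𝔓 (c j) (c 3) (hc 3) *
          algebraMap R (blowupAlgebra 𝔓 (c j)) H) = 0 :=
    Ideal.Quotient.eq_zero_iff_mem.mpr hmem
  have hq : ε (T 0 * T 1 - T 2 * T 3 * MvPolynomial.C (Ideal.Quotient.mk _ H)) = 0 := by
    rw [map_sub, map_mul, map_mul, map_mul, hT, hT, hT, hT, hεC, ← h0]
    simp only [← map_mul, ← map_sub]
  have hq0 : T 0 * T 1 - T 2 * T 3 * MvPolynomial.C (Ideal.Quotient.mk _ H) = 0 :=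
    ε.injective (hq.trans (map_zero ε).symm)
  -- substitute `T₀, T₁ ↦ X`, `T₂, T₃ ↦ 0`
  let τ : {k : Fin 4 // k ≠ j} → Polynomial (R ⧸ Ideal.span (Set.range c)) := fun k =>
    if k.1.val < 2 then Polynomial.X else 0
  have hτ : ∀ k, MvPolynomial.aeval τ (T k) =
      if k = j then 1 else if k.val < 2 then Polynomial.X else 0 := by
    intro k
    by_cases h : k = j
    · simp [T, h]
    · simp [T, τ, h]
  have h23 : MvPolynomial.aeval τ (T 2) * MvPolynomial.aeval τ (T 3) = 0 := by
    rw [hτ, hτ]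
    by_cases h2 : (2 : Fin 4) = j
    · have h3 : (3 : Fin 4) ≠ j := by rw [← h2]; decide
      simp [h3]
    · simp [h2]
  have h01 : MvPolynomial.aeval τ (T 0) * MvPolynomial.aeval τ (T 1) ≠ 0 := by
    rw [hτ, hτ]
    by_cases h0' : (0 : Fin 4) = j
    · have h1 : (1 : Fin 4) ≠ j := by rw [← h0']; decide
      simp [← h0', Polynomial.X_ne_zero]
    · by_cases h1 : (1 : Fin 4) = j
      · simp [← h1, Polynomial.X_ne_zero]
      · simp only [h0', h1, if_false, show ((0 : Fin 4) : ℕ) < 2 from by decide,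
          show ((1 : Fin 4) : ℕ) < 2 from by decide, if_true]
        exact mul_ne_zero Polynomial.X_ne_zero Polynomial.X_ne_zero
  apply h01
  have := congrArg (MvPolynomial.aeval τ) hq0
  rw [map_sub, map_mul, map_mul, map_mul, h23, zero_mul, sub_zero, map_zero] at this
  exact this

/-- **The chart `D₊(c̄_j)` of the blow-up of the hypersurface `Spec R/(F)`, `F = c₀c₁ - c₂c₃H`, in
`𝔓̄` is cut out of the chart `R[𝔓/c_j]` of the blow-up of `Spec R` by the strict transform `f`**:
`R[𝔓/c_j]/(f) ≅ (R/(F))[𝔓̄/c̄_j]` compatibly with `R → R/(F)` and the chart generators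
(Görtz–Wedhorn 13.96 (2) via `blowupAlgebra.quotientKerMapQuotientEquiv`: `c_j` is prime in
`R[𝔓/c_j]` and does not divide `f`) — de Jong 1996, 4.27: "Chart "`t₁ ≠ 0`". Here we have …
equations `u = t₁u'`, `v = t₁v'`, `t₂ = t₁t₂'` and `u'v' - t₂'t₃ ⋯ t_s = 0`."
[cite: DeJong1996, 4.27, p. 76] [cite: GortzWedhorn2020, Prop. 13.96 (2)] -/
theorem chartsOverCentre_exists_strictTransform_equiv {R : Type u} [CommRing R]
    [IsRegularLocalRing R] (c : Fin 4 → R) (j : Fin 4) {l : ℕ} (w : Fin l → R)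
    (hz : Ideal.span (Set.range (Fin.append c w)) = maximalIdeal R)
    (hd : (maximalIdeal R).spanFinrank = 4 + l)
    (𝔓 : Ideal R) (h𝔓 : 𝔓 = Ideal.span (Set.range c)) (hc : ∀ k, c k ∈ 𝔓) (H F : R)
    (hF : F = c 0 * c 1 - c 2 * c 3 * H) :
    ∃ Ψ : (blowupAlgebra 𝔓 (c j) ⧸ Ideal.span
        {blowupAlgebra.gen 𝔓 (c j) (c 0) (hc 0) * blowupAlgebra.gen 𝔓 (c j) (c 1) (hc 1) -
          blowupAlgebra.gen 𝔓 (c j) (c 2) (hc 2) * blowupAlgebra.gen 𝔓 (c j) (c 3) (hc 3) *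
            algebraMap R (blowupAlgebra 𝔓 (c j)) H}) ≃+*
        blowupAlgebra (𝔓.map (Ideal.Quotient.mk (Ideal.span {F})))
          (Ideal.Quotient.mk (Ideal.span {F}) (c j)),
      (∀ r : R, Ψ (Ideal.Quotient.mk _ (algebraMap R _ r)) =
        algebraMap (R ⧸ Ideal.span {F}) _ (Ideal.Quotient.mk _ r)) ∧
      (∀ k, Ψ (Ideal.Quotient.mk _ (blowupAlgebra.gen 𝔓 (c j) (c k) (hc k))) =
        blowupAlgebra.gen (𝔓.map (Ideal.Quotient.mk (Ideal.span {F})))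
          (Ideal.Quotient.mk (Ideal.span {F}) (c j)) (Ideal.Quotient.mk _ (c k))
          (Ideal.mem_map_of_mem _ (hc k))) := by
  have hf : algebraMap R (blowupAlgebra 𝔓 (c j)) F = algebraMap R (blowupAlgebra 𝔓 (c j)) (c j) ^ 2 *
      (blowupAlgebra.gen 𝔓 (c j) (c 0) (hc 0) * blowupAlgebra.gen 𝔓 (c j) (c 1) (hc 1) -
        blowupAlgebra.gen 𝔓 (c j) (c 2) (hc 2) * blowupAlgebra.gen 𝔓 (c j) (c 3) (hc 3) *
          algebraMap R (blowupAlgebra 𝔓 (c j)) H) := by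
    rw [hF, chartsOverCentre_algebraMap_relation c 𝔓 hc j H]
  have hprime := chartsOverCentre_prime_algebraMap c j w hz hd 𝔓 h𝔓 hc
  have hndvd : ¬ algebraMap R (blowupAlgebra 𝔓 (c j)) (c j) ∣
      (blowupAlgebra.gen 𝔓 (c j) (c 0) (hc 0) * blowupAlgebra.gen 𝔓 (c j) (c 1) (hc 1) -
        blowupAlgebra.gen 𝔓 (c j) (c 2) (hc 2) * blowupAlgebra.gen 𝔓 (c j) (c 3) (hc 3) *
          algebraMap R (blowupAlgebra 𝔓 (c j)) H) := fun hdvd =>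
    chartsOverCentre_strictTransform_notMem c j w hz hd 𝔓 h𝔓 hc H (Ideal.mem_span_singleton.mpr hdvd)
  refine ⟨blowupAlgebra.quotientKerMapQuotientEquiv 𝔓 (c j) hf hprime hndvd, fun r => ?_, fun k => ?_⟩
  · rw [blowupAlgebra.quotientKerMapQuotientEquiv_mk, blowupAlgebra.mapQuotient_algebraMap]
  · rw [blowupAlgebra.quotientKerMapQuotientEquiv_mk, blowupAlgebra.mapQuotient_gen]

end Summit.ResolutionOfSingularities.ResolutionOfSingularities.Theorems

end
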